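import Summits.NavierStokesRegularity.NavierStokesRegularity.Theses.AdaptedFrequency
import Literature.Analysis.FluidPDE.AdaptedBackwardKernel
import Literature.Analysis.FluidPDE.ClassicalSolution
import Summits.NavierStokesRegularity.NavierStokesRegularity.Theorems.AdaptedFrequencyAdaptedFrequencyConvergesStubPinchingUpper
import Summits.NavierStokesRegularity.NavierStokesRegularity.Theorems.AdaptedFrequencyAdaptedFrequencyConvergesStubPinchingLower
import Summits.NavierStokesRegularity.NavierStokesRegularity.Theorems.AdaptedFrequencyAdaptedFrequencyConvergesStubHullTransfer
import Summits.NavierStokesRegularity.NavierStokesRegularity.Theorems.AdaptedFrequencyAdaptedFrequencyConvergesStubKatoL1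
import Summits.NavierStokesRegularity.NavierStokesRegularity.Theorems.AdaptedFrequencyAdaptedFrequencyConvergesStubBlockSolver
import Summits.NavierStokesRegularity.NavierStokesRegularity.Theorems.AdaptedFrequencyAdaptedFrequencyConvergesStubDoeblin
import Summits.NavierStokesRegularity.NavierStokesRegularity.Theorems.AdaptedFrequencyAdaptedFrequencyConvergesStubCorotationNeutral

/-!
# Crux `AdaptedFrequencyConverges` (stmt-NavierStokesRegularity-10493), line `cloud-frame-effective-tsai`:
  what the line PROVED — kernel uniqueness, and the reduction of the crux to rigidity of pinched eternal pairs

Helper file (`--supports` the crux item; lead prover-line-stmt-NavierStokesRegularity-10493-c1-0).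
With the five landed stubs of the line (`stub_hullTransfer` p102658, `stub_katoL1` p98520,
`stub_blockSolver` p107892, `stub_doeblin` p111559, `stub_corotationNeutral` p98676) and the two
landed pinchings of line `tauberian-omega-limit` (`stub_pinchingUpper` p78510, `stub_pinchingLower`
p82804), this file records, sorry-free:

* `adaptedKernel_unique_typeI` — **uniqueness of the adapted kernel** (card lever 1): for a
  smooth divergence-free Type-I drift `‖b(t,x)‖ ≤ C/√(T−t)` on a time set `S ⊆ (−∞,T)` closed
  under `t ↦ [t,T)`, two Gaussian-comparable adapted backward kernels with the same pole `(T,x₀)`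
  coincide on `S` (Kato `L¹`-accretivity + block solver + Doeblin iteration; only the UPPER
  Gaussian bounds are used by the proof);
* `adaptedFrequencyConverges_of_pinchedHullHStationary` — **the crux follows from h-stationarity
  of pinched eternal pairs** (the K2 statement of the crux chain): if every eternal Type-I pair
  `(v,q,K)` at viscosity `ν` (classical NS on `ℝ³×(−∞,0)`, `‖v‖ ≤ C/√(−t)`, `K` adapted on
  `(−∞,0)` with pole `(0,0)`, Gaussian-comparable, and — a usable extra hypothesis, free by
  `adaptedKernel_unique_typeI` — unique among such) whose rescaled adapted enstrophy
  `h̄(τ) = (−τ)²·∫‖curl v(τ)‖²K(τ)` is pinched between positive constants has CONSTANT `h̄`, then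
  `AdaptedFrequencyConverges` holds (pinching + `stub_hullTransfer`);
* `adaptedFrequencyConverges_of_rotatedHull` — the line's composition: the single open stub
  `stub_rotatedHull` (pinched eternal pairs with unique kernel are rotated self-similar modulo a
  wobble, with co-moving kernel) implies the crux (`stub_corotationNeutral` supplies constancy).

So the crux is now EQUIVALENT-in-practice to a Liouville/rigidity statement about pinched eternal
Type-I pairs (the converse reduction, crux ⇒ slow decrease ⇒ …, is the disprover's Part J), and
together with `FrequencyRigidity` (stmt-2955, which kills the constant-`h̄` pairs) the route's
remaining content is: NO pinched eternal Type-I pair exists.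
-/

noncomputable section

namespace Summit.NavierStokesRegularity.NavierStokesRegularity.Theorems.AdaptedFrequencyConverges.CloudFrameEffectiveTsai

open scoped Topology
open Literature.Analysis.FluidPDE Set Filter MeasureTheory Function
open Summit.NavierStokesRegularity.NavierStokesRegularity.Theses.AdaptedFrequency

/-- **Uniqueness of the Gaussian-comparable adapted kernel of a Type-I drift** (card lever 1 of
line `cloud-frame-effective-tsai`; Doeblin assembly `stub_doeblin` of Kato `L¹`-accretivity
`stub_katoL1` and the block solver `stub_blockSolver`): on a time set `S ⊆ (−∞,T)` closed under
`t ↦ [t,T)`, for a jointly smooth divergence-free drift with `‖b(t,x)‖ ≤ C/√(T−t)`, two adapted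
backward kernels with pole `(T,x₀)` which are two-sided Gaussian-comparable agree on `S`. -/
theorem adaptedKernel_unique_typeI :
    ∀ (ν C T : ℝ) (S : Set ℝ), 0 < ν → S ⊆ Iio T → (∀ t ∈ S, Ico t T ⊆ S) → ∀ (b : ℝ → (EuclideanSpace ℝ (Fin 3)) → (EuclideanSpace ℝ (Fin 3))), IsSmoothSpaceTimeOn S b → (∀ t ∈ S, VectorCalculus.IsDivFree (b t)) → (∀ t ∈ S, ∀ x, ‖b t x‖ ≤ C / Real.sqrt (T - t)) → ∀ (x₀ : (EuclideanSpace ℝ (Fin 3))) (K₁ K₂ : ℝ → (EuclideanSpace ℝ (Fin 3)) → ℝ), IsAdaptedBackwardKernel ν b S T x₀ K₁ → IsGaussianComparable K₁ S T x₀ → IsAdaptedBackwardKernel ν b S T x₀ K₂ → IsGaussianComparable K₂ S T x₀ → ∀ t ∈ S, K₁ t = K₂ t :=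
  stub_doeblin stub_katoL1 stub_blockSolver

/-- **The crux follows from h-stationarity of pinched eternal pairs** (K2 form of the crux
chain). Hypothesis: every eternal Type-I pair `(v,q,K)` at viscosity `ν` — classical NS on
`ℝ³ × (−∞,0)`, `‖v(t,x)‖ ≤ C/√(−t)`, `K` an adapted kernel of `v` on `(−∞,0)` with pole `(0,0)`,
Gaussian-comparable and unique among such — whose rescaled adapted enstrophy
`(−τ)²·adaptedEnstrophy v K τ` is pinched in `[c, C']`, `c > 0`, has it CONSTANT on `(−∞,0)`.
Conclusion: `AdaptedFrequencyConverges`. Proof: if `Λ` had no limit at a Type-I singular point,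
the landed two-sided pinching (`stub_pinchingLower`, `stub_pinchingUpper`) and the hull transfer
(`stub_hullTransfer`) produce a pinched eternal pair with NON-constant `h̄`, whose kernel is unique
by `adaptedKernel_unique_typeI`. -/
theorem adaptedFrequencyConverges_of_pinchedHullHStationary :
    (∀ (ν C c C' : ℝ) (v : ℝ → (EuclideanSpace ℝ (Fin 3)) → (EuclideanSpace ℝ (Fin 3))) (q : ℝ → (EuclideanSpace ℝ (Fin 3)) → ℝ) (K : ℝ → (EuclideanSpace ℝ (Fin 3)) → ℝ), 0 < ν → 0 < c → IsClassicalNSSolutionOn (Iio 0) ν 0 v q → (∀ t ∈ Iio (0:ℝ), ∀ x, ‖v t x‖ ≤ C / Real.sqrt (-t)) → IsAdaptedBackwardKernel ν v (Iio 0) 0 0 K → IsGaussianComparable K (Iio 0) 0 0 → (∀ K' : ℝ → (EuclideanSpace ℝ (Fin 3)) → ℝ, IsAdaptedBackwardKernel ν v (Iio 0) 0 0 K' → IsGaussianComparable K' (Iio 0) 0 0 → ∀ t ∈ Iio (0:ℝ), K' t = K t) → (∀ τ ∈ Iio (0:ℝ), c ≤ (-τ) ^ 2 * adaptedEnstrophy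 v K τ ∧ (-τ) ^ 2 * adaptedEnstrophy v K τ ≤ C') → ∀ τ₁ τ₂ : ℝ, τ₁ < 0 → τ₂ < 0 → (-τ₁) ^ 2 * adaptedEnstrophy v K τ₁ = (-τ₂) ^ 2 * adaptedEnstrophy v K τ₂) →
    AdaptedFrequencyConverges := by
  intro hstat ν T hν hT u p hcl hLH hdec hTI x₀ t₀ G ht₀ hsing hK hcomp H Λ hH hΛ
  have hker : IsAdaptedBackwardKernel ν u (Ico t₀ T) T x₀ G := isAdaptedBackwardKernel_iff.2 hK
  have hcmp : IsGaussianComparable G (Ico t₀ T) T x₀ := isGaussianComparable_iff_fin_three.2 hcomp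
  -- `H` is the adapted enstrophy, `Λ` the adapted frequency
  have hH' : H = adaptedEnstrophy u G := by
    rw [hH]; funext t; rfl
  have hΛ' : Λ = adaptedFrequency u G T := by
    rw [hΛ, hH']; funext t; rfl
  rw [hΛ']
  by_contra hnot
  -- pinching near `T` on a common window `[t₁, T)` (landed stubs of line tauberian-omega-limit)
  obtain ⟨t₂, ht₂, C₁, hup⟩ :=
    TauberianOmegaLimit.stub_pinchingUpper ν T u p x₀ t₀ G hν hT hcl hLH hdec hTI ht₀ hsing hker hcmp
  obtain ⟨t₂', ht₂', c₀, hc₀, hlow⟩ :=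
    TauberianOmegaLimit.stub_pinchingLower ν T u p x₀ t₀ G hν hT hcl hLH hdec hTI ht₀ hsing hker hcmp
  set t₁ : ℝ := max t₂ t₂' with ht₁
  have ht₁mem : t₁ ∈ Ico t₀ T :=
    ⟨ht₂.1.trans (le_max_left _ _), max_lt ht₂.2 ht₂'.2⟩
  have hpinch : ∀ t ∈ Ico t₁ T,
      c₀ ≤ (T - t) ^ 2 * adaptedEnstrophy u G t ∧ (T - t) ^ 2 * adaptedEnstrophy u G t ≤ C₁ :=
    fun t ht => ⟨hlow t ⟨(le_max_right _ _).trans ht.1, ht.2⟩,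
      hup t ⟨(le_max_left _ _).trans ht.1, ht.2⟩⟩
  -- the pinched eternal tangent pair with non-constant `h̄`
  obtain ⟨C, c', C', v, q, K, hc', hv, hvI, hKv, hKc, hpin, τ₁, τ₂, hτ₁, hτ₂, hne⟩ :=
    stub_hullTransfer ν T u p x₀ t₀ G hν hT hcl hLH hdec hTI ht₀ hsing hker hcmp t₁ c₀ C₁ ht₁mem hc₀
      hpinch hnot
  -- uniqueness of its comparable kernel
  have huniq : ∀ K' : ℝ → (EuclideanSpace ℝ (Fin 3)) → ℝ, IsAdaptedBackwardKernel ν v (Iio 0) 0 0 K' →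
      IsGaussianComparable K' (Iio 0) 0 0 → ∀ t ∈ Iio (0:ℝ), K' t = K t := by
    intro K' hK' hK'c
    refine adaptedKernel_unique_typeI ν C 0 (Iio 0) hν Subset.rfl (fun t _ => Ico_subset_Iio_self) v
      hv.smooth_velocity hv.divFree ?_ 0 K' K hK' hK'c hKv hKc
    intro t ht x
    simpa using hvI t ht x
  exact hne (hstat ν C c' C' v q K hν hc' hv hvI hKv hKc huniq hpin τ₁ τ₂ hτ₁ hτ₂)

/-- **The line's composition**: the single open stub `stub_rotatedHull` — every pinched eternal
Type-I pair with unique comparable kernel is rotated self-similar modulo a wobble, with co-moving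
kernel — implies the crux, because such pairs have constant rescaled adapted enstrophy
(`stub_corotationNeutral`, landed) and `adaptedFrequencyConverges_of_pinchedHullHStationary`. -/
theorem adaptedFrequencyConverges_of_rotatedHull :
    (∀ (ν C c C' : ℝ) (v : ℝ → (EuclideanSpace ℝ (Fin 3)) → (EuclideanSpace ℝ (Fin 3))) (q : ℝ → (EuclideanSpace ℝ (Fin 3)) → ℝ) (K : ℝ → (EuclideanSpace ℝ (Fin 3)) → ℝ), 0 < ν → 0 < c → IsClassicalNSSolutionOn (Iio 0) ν 0 v q → (∀ t ∈ Iio (0:ℝ), ∀ x, ‖v t x‖ ≤ C / Real.sqrt (-t)) → IsAdaptedBackwardKernel ν v (Iio 0) 0 0 K → IsGaussianComparable K (Iio 0) 0 0 → (∀ K' : ℝ → (EuclideanSpace ℝ (Fin 3)) → ℝ, IsAdaptedBackwardKernel ν v (Iio 0) 0 0 K' → IsGaussianComparable K' (Iio 0) 0 0 → ∀ t ∈ Iio (0:ℝ), K' t = K t) → (∀ τ ∈ Iio (0:ℝ), c ≤ (-τ) ^ 2 * adaptedEnstrophy v K τ ∧ (-τ) ^ 2 * adaptedEnstrophy v K τ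 ≤ C') → ∃ (V : (EuclideanSpace ℝ (Fin 3)) → (EuclideanSpace ℝ (Fin 3))) (𝒦 : (EuclideanSpace ℝ (Fin 3)) → ℝ) (R : ℝ → ((EuclideanSpace ℝ (Fin 3)) ≃ₗᵢ[ℝ] (EuclideanSpace ℝ (Fin 3)))) (m w : ℝ → (EuclideanSpace ℝ (Fin 3))), Differentiable ℝ V ∧ (∀ t ∈ Iio (0:ℝ), ∀ x, v t x = (Real.sqrt (-t))⁻¹ • (R t) (V ((Real.sqrt (-t))⁻¹ • (R t).symm (x - m t))) + w t) ∧ (∀ t ∈ Iio (0:ℝ), ∀ x, K t x = (-t) ^ (-(3:ℝ) / 2) * 𝒦 ((Real.sqrt (-t))⁻¹ • (R t).symm (x - m t)))) →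
    AdaptedFrequencyConverges := by
  intro hrot
  refine adaptedFrequencyConverges_of_pinchedHullHStationary ?_
  intro ν C c C' v q K hν hc hv hvI hKv hKc huniq hpin τ₁ τ₂ hτ₁ hτ₂
  obtain ⟨V, 𝒦, R, m, w, hV, hvrep, hKrep⟩ := hrot ν C c C' v q K hν hc hv hvI hKv hKc huniq hpin
  exact stub_corotationNeutral v K V 𝒦 R m w hV hvrep hKrep τ₁ τ₂ hτ₁ hτ₂

end Summit.NavierStokesRegularity.NavierStokesRegularity.Theorems.AdaptedFrequencyConverges.CloudFrameEffectiveTsai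

end
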